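import Summits.CriticalPhenomena.PercolationContinuityZ3.Theorems.PercNearOneGluingNoHeavyLowerTailKNGoodGMgcTarget
import Summits.CriticalPhenomena.PercolationContinuityZ3.Theorems.PercNearOneGluingNoHeavyLowerTailKNGoodGMgcBoundary
import Summits.CriticalPhenomena.PercolationContinuityZ3.Theorems.PercNearOneGluingNoHeavyLowerTailKNGoodGainLemmas
import Summits.CriticalPhenomena.PercolationContinuityZ3.Theorems.PercNearOneGluingNoHeavyLowerTailKNGoodGCThreeAdjacent
import HarnessLib

/-!
# THEOREM B (Kozma–Nitzan goodness: the gluing inequality WITH A GRANDCHILD) as a tree theorem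
# (`NoHeavyLowerTail` cell, stmt-CriticalPhenomena-4575; prover `prim-hp-2`, gen 19 — assembly L6 of the semantic layer,
# memos `run/shared/lean/prim/prim-hp-2/MEMO-gen15-grandchild-certificates.md` §3, §6 and `MEMO-gen17-lean-certificates.md` §4')

Support file (`--supports stmt-CriticalPhenomena-4575`; imports the COMPUTATIONAL certificate layer `…KNGoodGMgcTheoremB` through
`…Boundary`, and `…SideGlue`/`…TargetAlgebra`).  No definitions, no named facts, no sorries.

SETTING (MEMO-gen15 §3a).  A core `C` (any finite weighted graph) with three relays `a₁, a₂, a₃` labelled by core reliability towards `b`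
(`s₁ ≤ s₂ ≤ s₃`), three PENDANT stars `x, y, z` whose hairs go to the relays, and the three inner pairs `xy, xz, yz` of arbitrary weights:
`K = C + x + y + z + pairs` (weights `u`, `Verts.Pendant`).  The contraction `K/{x,y}` is realised as `u' = u[s(x,y) ↦ 1]` with observer `x`
(its child is the grandchild `z`).
* **`Verts.gm_grandchild`** — if the relay `j` is loneliest in `K` (`μ_u(j b) ≤ μ_u(a b)` for the three relays), then
  `μ_{u'}(j b) ≤ μ_{u'}(x b) + Σ_{W ∩ A = ∅} μ_{u'}(C(x) = W) · min_{a ∈ A} μ_{u'}(a ↔ b off W)` — the goodness functional of `x` in `u'`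
  at the witness `j` is nonnegative (THEOREM B / GM-gc).
* **`gm_grandchild_row`** — the same with the frame unbundled (vertices, distinctness, pendant hypotheses, the core as
  `fun e => if x ∈ e then 0 else if y ∈ e then 0 else if z ∈ e then 0 else u e`), in the style of `KNGoodGC3Adj.gc_threeRelays_row`.
* **`knGood_twoChildren_grandchild`** — COROLLARY (first 4-vertex observer side): `o ∉ A` joined (besides relay hairs) to exactly two children
  `x, y`, which are joined to the relays, to each other and to a grandchild `z` (joined to `x, y` and the relays only): `KNGood w A hA o b` — the
  series socket `KNGoodSeries.knGood_series_of_gluing` fed with `gm_grandchild_row` (the children are good in `G − o` by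
  `KNGoodGC3Adj.knGood_twoChildren_threeRelays`).
* `knGood_oneChild_threeBelow` — the other easy 4-vertex side: `o` with ONE child `x` above any three-vertex cluster `{x,y,z}`
  (Kozma–Nitzan Thm 5 + `knGood_twoChildren_threeRelays` in `G ∖ o`).  Remaining for "every observer side ≤ 4 vertices": `o` with THREE
  children (star-peeling socket `KNGoodBranching.knGood_of_starNeed`, next generation).
PROOF.  `Verts.target_expansion` (the functional equals `Σ_v Φ_v(j;r)(X)·v_v` with `r` the loneliest relay of `C + z` and
`v = (α,β,γ,δ,ε)` the five core scalars), the loneliness rows in world-law form (`Verts.row_21/31/32`), the realizable cone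
(`α, β ≥ 0` labels; `γ ≥ 0` `KNGoodHair.glueTransfer_openConn`; `δ ≥ α`, `ε ≥ −β` `KNGoodGain.*`), and the certificates on the closed box
(`free_j1/j2/j3`, = `theoremB_certificates` + Fourier–Motzkin + the boundary argument).
-/

noncomputable section

namespace Summit.CriticalPhenomena.PercolationContinuityZ3.Theorems

namespace KNGoodGMgc

open MeasureTheory Set Literature.Probability.LatticeModels Literature.Probability.Percolation KNGoodAux KNGoodHair
open scoped Classical BigOperators

variable {n : ℕ}

namespace Verts

variable (V : Verts n)

/-- The glued core `[12]` is the core with the pair `a₁a₂` glued. [this work] -/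
theorem glued_three_eq (u : Sym2 (Fin n) → unitInterval) : V.glued u 3 = Function.update (V.core u) s(V.a₁, V.a₂) 1 := by
  funext f; simp [glued, Function.update_apply]
/-- The glued core `[13]` is the core with the pair `a₁a₃` glued. [this work] -/
theorem glued_five_eq (u : Sym2 (Fin n) → unitInterval) : V.glued u 5 = Function.update (V.core u) s(V.a₁, V.a₃) 1 := by
  funext f; simp [glued, Function.update_apply]
/-- The glued core `[23]` is the core with the pair `a₂a₃` glued. [this work] -/
theorem glued_six_eq (u : Sym2 (Fin n) → unitInterval) : V.glued u 6 = Function.update (V.core u) s(V.a₂, V.a₃) 1 := by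
  funext f; simp [glued, Function.update_apply]

/-- **The realizable cone** of the five core scalars: `α, β ≥ 0` (labels), `γ ≥ 0` (gluing transfer), `δ ≥ α` and `ε ≥ −β` (gain lemmas).
[this work] -/
theorem cone (u : Sym2 (Fin n) → unitInterval) (b : Fin n)
    (hs12 : (prodBernoulli (V.core u)).real (openConn V.a₁ b) ≤ (prodBernoulli (V.core u)).real (openConn V.a₂ b))
    (hs23 : (prodBernoulli (V.core u)).real (openConn V.a₂ b) ≤ (prodBernoulli (V.core u)).real (openConn V.a₃ b)) :
    0 ≤ V.R u b 0 2 - V.R u b 0 1 ∧ 0 ≤ V.R u b 0 3 - V.R u b 0 2 ∧ 0 ≤ V.R u b 5 1 - V.R u b 5 2 ∧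
      V.R u b 0 2 - V.R u b 0 1 ≤ V.R u b 6 2 - V.R u b 6 1 ∧ -(V.R u b 0 3 - V.R u b 0 2) ≤ V.R u b 3 1 - V.R u b 3 3 := by
  have e01 : V.R u b 0 1 = (prodBernoulli (V.core u)).real (openConn V.a₁ b) := V.rel_zero u b V.a₁
  have e02 : V.R u b 0 2 = (prodBernoulli (V.core u)).real (openConn V.a₂ b) := V.rel_zero u b V.a₂
  have e03 : V.R u b 0 3 = (prodBernoulli (V.core u)).real (openConn V.a₃ b) := V.rel_zero u b V.a₃
  have e51 : V.R u b 5 1 = (prodBernoulli (Function.update (V.core u) s(V.a₁, V.a₃) 1)).real (openConn V.a₁ b) := by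
    rw [← V.glued_five_eq]; rfl
  have e52 : V.R u b 5 2 = (prodBernoulli (Function.update (V.core u) s(V.a₁, V.a₃) 1)).real (openConn V.a₂ b) := by
    rw [← V.glued_five_eq]; rfl
  have e61 : V.R u b 6 1 = (prodBernoulli (Function.update (V.core u) s(V.a₂, V.a₃) 1)).real (openConn V.a₁ b) := by
    rw [← V.glued_six_eq]; rfl
  have e62 : V.R u b 6 2 = (prodBernoulli (Function.update (V.core u) s(V.a₂, V.a₃) 1)).real (openConn V.a₂ b) := by
    rw [← V.glued_six_eq]; rfl
  have e31 : V.R u b 3 1 = (prodBernoulli (Function.update (V.core u) s(V.a₁, V.a₂) 1)).real (openConn V.a₂ b) := by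
    rw [← V.glued_three_eq]; exact V.rel_tie_12 u b
  have e33 : V.R u b 3 3 = (prodBernoulli (Function.update (V.core u) s(V.a₁, V.a₂) 1)).real (openConn V.a₃ b) := by
    rw [← V.glued_three_eq]; rfl
  refine ⟨by rw [e01, e02]; linarith, by rw [e02, e03]; linarith, ?_, ?_, ?_⟩
  · -- γ ≥ 0
    have h := glueTransfer_openConn (V.core u) V.a₁ V.a₃ V.a₂ b V.h13 hs23
    rw [e51, e52]; linarith
  · -- δ ≥ α
    have h := KNGoodGain.gain_bystander_le_of_le_partner (V.core u) V.a₂ V.a₃ V.a₁ b V.h23 hs23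
    rw [e01, e02, e61, e62]; linarith
  · -- ε ≥ -β
    have h := KNGoodGain.gain_bystander_le_of_le_bystander (V.core u) V.a₂ V.a₁ V.a₃ b (Ne.symm V.h12) hs23
    rw [Sym2.eq_swap] at h
    rw [e02, e03, e31, e33]; linarith

/-- **THEOREM B (GM with a grandchild).**  For the loneliest relay `j` of `K`, the goodness functional of the contracted observer
`x` of `u' = u[s(x,y) ↦ 1]` at the witness `j` is nonnegative. [this work] -/
theorem gm_grandchild {u : Sym2 (Fin n) → unitInterval} (hP : V.Pendant u) (b : Fin n)
    (hb : b ∉ ({V.x, V.y, V.z} : Finset (Fin n))) (hA : ({V.a₁, V.a₂, V.a₃} : Finset (Fin n)).Nonempty)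
    (hs12 : (prodBernoulli (V.core u)).real (openConn V.a₁ b) ≤ (prodBernoulli (V.core u)).real (openConn V.a₂ b))
    (hs23 : (prodBernoulli (V.core u)).real (openConn V.a₂ b) ≤ (prodBernoulli (V.core u)).real (openConn V.a₃ b))
    (j : Fin n) (hj : j ∈ ({V.a₁, V.a₂, V.a₃} : Finset (Fin n)))
    (hrow : ∀ a ∈ ({V.a₁, V.a₂, V.a₃} : Finset (Fin n)), (prodBernoulli u).real (openConn j b) ≤ (prodBernoulli u).real (openConn a b)) :
    (prodBernoulli (Function.update u (V.e 11) 1)).real (openConn j b) ≤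
      (prodBernoulli (Function.update u (V.e 11) 1)).real (openConn V.x b) +
        ∑ W ∈ nullSets ({V.a₁, V.a₂, V.a₃} : Finset (Fin n)),
          (prodBernoulli (Function.update u (V.e 11) 1)).real (clusterIs V.x W) *
            ({V.a₁, V.a₂, V.a₃} : Finset (Fin n)).inf' hA
              (fun a => (prodBernoulli (Function.update u (V.e 11) 1)).real (openConnIn ((↑W : Set (Fin n))ᶜ) a b)) := by
  set A : Finset (Fin n) := {V.a₁, V.a₂, V.a₃} with hAdef
  set uz := restrW ((↑({V.x, V.y} : Finset (Fin n)) : Set (Fin n))ᶜ) (Function.update u (V.e 11) 1) with huz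
  -- the loneliest relay of `C + z`
  obtain ⟨r₀, hr₀A, hr₀min⟩ := A.exists_min_image (fun a => (prodBernoulli uz).real (openConn a b)) hA
  -- indices
  have hidx : ∀ a ∈ A, ∃ i : ℕ, (i = 1 ∨ i = 2 ∨ i = 3) ∧ V.relay i = a := by
    intro a ha; simp only [hAdef, Finset.mem_insert, Finset.mem_singleton] at ha
    rcases ha with rfl | rfl | rfl
    · exact ⟨1, Or.inl rfl, rfl⟩
    · exact ⟨2, Or.inr (Or.inl rfl), rfl⟩
    · exact ⟨3, Or.inr (Or.inr rfl), rfl⟩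
  obtain ⟨j', hj', rfl⟩ := hidx j hj
  obtain ⟨r', hr', rfl⟩ := hidx r₀ hr₀A
  have hs1 : ∀ a ∈ A, (prodBernoulli (V.core u)).real (openConn V.a₁ b) ≤ (prodBernoulli (V.core u)).real (openConn a b) := by
    intro a ha; simp only [hAdef, Finset.mem_insert, Finset.mem_singleton] at ha
    rcases ha with rfl | rfl | rfl
    · exact le_rfl
    · exact hs12
    · exact hs12.trans hs23
  have hT := V.target_expansion hP b hb j' r' hj' hr' hA hr₀min hs1
  obtain ⟨cα, cβ, cγ, cδ, cε⟩ := V.cone u b hs12 hs23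
  have hx := V.X_mem u
  have ha₁ : V.a₁ ∈ A := by simp [hAdef]
  have ha₂ : V.a₂ ∈ A := by simp [hAdef]
  have ha₃ : V.a₃ ∈ A := by simp [hAdef]
  have r21 : (prodBernoulli u).real (openConn V.a₂ b) - (prodBernoulli u).real (openConn V.a₁ b) =
      worldQ 0 (V.X u) * (V.R u b 0 2 - V.R u b 0 1) - worldQ 5 (V.X u) * (V.R u b 5 1 - V.R u b 5 2) +
        worldQ 6 (V.X u) * (V.R u b 6 2 - V.R u b 6 1) := V.row_21 hP b hb
  have r31 : (prodBernoulli u).real (openConn V.a₃ b) - (prodBernoulli u).real (openConn V.a₁ b) =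
      worldQ 0 (V.X u) * ((V.R u b 0 2 - V.R u b 0 1) + (V.R u b 0 3 - V.R u b 0 2)) -
        worldQ 3 (V.X u) * (V.R u b 3 1 - V.R u b 3 3) + worldQ 6 (V.X u) * (V.R u b 6 2 - V.R u b 6 1) := V.row_31 hP b hb
  have r32 : (prodBernoulli u).real (openConn V.a₃ b) - (prodBernoulli u).real (openConn V.a₂ b) =
      worldQ 0 (V.X u) * (V.R u b 0 3 - V.R u b 0 2) - worldQ 3 (V.X u) * (V.R u b 3 1 - V.R u b 3 3) +
        worldQ 5 (V.X u) * (V.R u b 5 1 - V.R u b 5 2) := V.row_32 hP b hb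
  have hΦ : 0 ≤ bexp 11 (fun c => phiHat j' r' c 0) (V.X u) * (V.R u b 0 2 - V.R u b 0 1) +
      bexp 11 (fun c => phiHat j' r' c 1) (V.X u) * (V.R u b 0 3 - V.R u b 0 2) +
      bexp 11 (fun c => phiHat j' r' c 2) (V.X u) * (V.R u b 5 1 - V.R u b 5 2) +
      bexp 11 (fun c => phiHat j' r' c 3) (V.X u) * (V.R u b 6 2 - V.R u b 6 1) +
      bexp 11 (fun c => phiHat j' r' c 4) (V.X u) * (V.R u b 3 1 - V.R u b 3 3) := by
    rcases hj' with rfl | rfl | rfl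
    · have h2 := hrow V.a₂ ha₂; have h3 := hrow V.a₃ ha₃
      change (prodBernoulli u).real (openConn V.a₁ b) ≤ _ at h2 h3
      exact free_j1 r' hr' (V.X u) hx _ _ _ _ _ cα cβ cδ (by linarith) (by linarith)
    · have h1 := hrow V.a₁ ha₁; have h3 := hrow V.a₃ ha₃
      change (prodBernoulli u).real (openConn V.a₂ b) ≤ _ at h1 h3
      exact free_j2 r' hr' (V.X u) hx _ _ _ _ _ cα cβ cγ cδ (by linarith) (by linarith)
    · have h1 := hrow V.a₁ ha₁; have h2 := hrow V.a₂ ha₂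
      change (prodBernoulli u).real (openConn V.a₃ b) ≤ _ at h1 h2
      exact free_j3 r' hr' (V.X u) hx _ _ _ _ _ cα cβ cγ cδ cε (by linarith) (by linarith)
  rw [← hT] at hΦ
  linarith

end Verts

/-- **THEOREM B, unbundled** (style of `KNGoodGC3Adj.gc_threeRelays_row`).  Three pendant stars `x, y, z` over the relays `a₁, a₂, a₃`
(labelled by core reliability) with arbitrary inner pairs; `j` the loneliest relay of `K = u`; then the goodness functional of the
observer `x` of `u[s(x,y) ↦ 1]` at `j` is nonnegative. [this work] -/
theorem gm_grandchild_row (u : Sym2 (Fin n) → unitInterval) (A : Finset (Fin n)) (hA : A.Nonempty)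
    (x y z b a₁ a₂ a₃ j : Fin n) (hAeq : A = {a₁, a₂, a₃}) (h12 : a₁ ≠ a₂) (h13 : a₁ ≠ a₃) (h23 : a₂ ≠ a₃)
    (hxy : x ≠ y) (hxz : x ≠ z) (hyz : y ≠ z) (hx : x ∉ A) (hy : y ∉ A) (hz : z ∉ A) (hbx : b ≠ x) (hby : b ≠ y) (hbz : b ≠ z)
    (hjA : j ∈ A)
    (hxN : ∀ t : Fin n, t ∉ A → t ≠ y → t ≠ z → u s(x, t) = 0)
    (hyN : ∀ t : Fin n, t ∉ A → t ≠ x → t ≠ z → u s(y, t) = 0)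
    (hzN : ∀ t : Fin n, t ∉ A → t ≠ x → t ≠ y → u s(z, t) = 0)
    (K : Sym2 (Fin n) → unitInterval) (hK : K = fun e => if x ∈ e then 0 else if y ∈ e then 0 else if z ∈ e then 0 else u e)
    (hs12 : (prodBernoulli K).real (openConn a₁ b) ≤ (prodBernoulli K).real (openConn a₂ b))
    (hs23 : (prodBernoulli K).real (openConn a₂ b) ≤ (prodBernoulli K).real (openConn a₃ b))
    (hrow : ∀ a ∈ A, (prodBernoulli u).real (openConn j b) ≤ (prodBernoulli u).real (openConn a b)) :
    (prodBernoulli (Function.update u s(x, y) 1)).real (openConn j b) ≤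
      (prodBernoulli (Function.update u s(x, y) 1)).real (openConn x b) +
        ∑ W ∈ nullSets A, (prodBernoulli (Function.update u s(x, y) 1)).real (clusterIs x W) *
          A.inf' hA (fun a' => (prodBernoulli (Function.update u s(x, y) 1)).real (openConnIn ((↑W : Set (Fin n))ᶜ) a' b)) := by
  have hxa : x ≠ a₁ ∧ x ≠ a₂ ∧ x ≠ a₃ := by refine ⟨?_, ?_, ?_⟩ <;> rintro rfl <;> simp [hAeq] at hx
  have hya : y ≠ a₁ ∧ y ≠ a₂ ∧ y ≠ a₃ := by refine ⟨?_, ?_, ?_⟩ <;> rintro rfl <;> simp [hAeq] at hy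
  have hza : z ≠ a₁ ∧ z ≠ a₂ ∧ z ≠ a₃ := by refine ⟨?_, ?_, ?_⟩ <;> rintro rfl <;> simp [hAeq] at hz
  let V : Verts n := ⟨x, y, z, a₁, a₂, a₃, hxy, hxz, hyz, hxa.1, hxa.2.1, hxa.2.2, hya.1, hya.2.1, hya.2.2, hza.1, hza.2.1, hza.2.2,
    h12, h13, h23⟩
  have hmemA : ∀ t, t ∉ A ↔ (t ≠ a₁ ∧ t ≠ a₂ ∧ t ≠ a₃) := fun t => by simp [hAeq]
  have hP : V.Pendant u :=
    ⟨fun t h1 h2 h3 h4 h5 => hxN t ((hmemA t).2 ⟨h1, h2, h3⟩) h4 h5,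
     fun t h1 h2 h3 h4 h5 => hyN t ((hmemA t).2 ⟨h1, h2, h3⟩) h4 h5,
     fun t h1 h2 h3 h4 h5 => hzN t ((hmemA t).2 ⟨h1, h2, h3⟩) h4 h5⟩
  have hcore : V.core u = K := by rw [hK]; rfl
  have hb : b ∉ ({V.x, V.y, V.z} : Finset (Fin n)) := by
    show b ∉ ({x, y, z} : Finset (Fin n)); simp [hbx, hby, hbz]
  subst hAeq
  have h := V.gm_grandchild hP b hb hA (by rw [hcore]; exact hs12) (by rw [hcore]; exact hs23) j hjA hrow
  simpa using h


open KNGoodSeries KNGoodSeriesEasy RelayNbhd KNGoodGC3 KNGoodGC3Adj in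
/-- **Observer with two children and a grandchild is good.**  `o, x, y, z ∉ A = {a₁,a₂,a₃}` distinct; the pairs at `o` go to
`A ∪ {x, y}`, at `x` to `A ∪ {o, y, z}`, at `y` to `A ∪ {o, x, z}`, at `z` to `A ∪ {x, y}` (all weights arbitrary, the core arbitrary);
`b ∉ {o, x, y, z}`.  Then `KNGood w A hA o b`. [this work] -/
theorem knGood_twoChildren_grandchild (w : Sym2 (Fin n) → unitInterval) (A : Finset (Fin n)) (hA : A.Nonempty)
    (o x y z b a₁ a₂ a₃ : Fin n) (hAeq : A = {a₁, a₂, a₃}) (h12 : a₁ ≠ a₂) (h13 : a₁ ≠ a₃) (h23 : a₂ ≠ a₃)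
    (ho : o ∉ A) (hx : x ∉ A) (hy : y ∉ A) (hz : z ∉ A) (hxo : x ≠ o) (hyo : y ≠ o) (hzo : z ≠ o) (hxy : x ≠ y) (hxz : x ≠ z)
    (hyz : y ≠ z) (hbo : b ≠ o) (hbx : b ≠ x) (hby : b ≠ y) (hbz : b ≠ z)
    (hoN : ∀ v : Fin n, v ≠ o → v ∉ A → v ≠ x → v ≠ y → w s(o, v) = 0)
    (hxN : ∀ t : Fin n, t ∉ A → t ≠ o → t ≠ y → t ≠ z → w s(x, t) = 0)
    (hyN : ∀ t : Fin n, t ∉ A → t ≠ o → t ≠ x → t ≠ z → w s(y, t) = 0)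
    (hzN : ∀ t : Fin n, t ∉ A → t ≠ x → t ≠ y → w s(z, t) = 0) :
    KNGood w A hA o b := by
  haveI : ∀ v : Sym2 (Fin n) → unitInterval, IsProbabilityMeasure (prodBernoulli v) := fun v => inferInstance
  -- delete the relay hairs at `o`
  set w' : Sym2 (Fin n) → unitInterval := fun e => if ∃ q ∈ A, e = s(o, q) then 0 else w e with hw'
  refine knGood_of_deleteHairs w A hA o b ho ?_
  rw [← hw']
  have hpin : pinW w' {e : Sym2 (Fin n) | o ∈ e ∧ ¬ e.IsDiag} ∅ = pinW w {e : Sym2 (Fin n) | o ∈ e ∧ ¬ e.IsDiag} ∅ := by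
    refine pinW_star_eq_of_eqOff w w' o fun e he => ?_
    rw [hw']; simp only
    rw [if_neg]
    rintro ⟨q, hq', rfl⟩
    exact he ⟨Sym2.mem_mk_left o q, fun hd => ho ((Sym2.mk_isDiag_iff.1 hd) ▸ hq')⟩
  set u := pinW w {e : Sym2 (Fin n) | o ∈ e ∧ ¬ e.IsDiag} ∅ with hu
  have huoff : ∀ c d : Fin n, c ≠ o → d ≠ o → u s(c, d) = w s(c, d) := by
    intro c d hc hd
    have hmem : s(c, d) ∉ {e : Sym2 (Fin n) | o ∈ e ∧ ¬ e.IsDiag} := by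
      rintro ⟨hoe, -⟩
      rcases Sym2.mem_iff.1 hoe with h | h
      · exact hc h.symm
      · exact hd h.symm
    rw [hu, pinW_apply_of_not_mem w ∅ hmem]
  have huo : ∀ v : Fin n, v ≠ o → u s(v, o) = 0 := by
    intro v hv; rw [Sym2.eq_swap, hu]; exact pinW_star_mk w hv
  have hxNu : ∀ t : Fin n, t ∉ A → t ≠ y → t ≠ z → u s(x, t) = 0 := by
    intro t htA hty htz
    by_cases hto : t = o
    · rw [hto]; exact huo x hxo
    · rw [huoff x t hxo hto]; exact hxN t htA hto hty htz
  have hyNu : ∀ t : Fin n, t ∉ A → t ≠ x → t ≠ z → u s(y, t) = 0 := by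
    intro t htA htx htz
    by_cases hto : t = o
    · rw [hto]; exact huo y hyo
    · rw [huoff y t hyo hto]; exact hyN t htA hto htx htz
  have hzNu : ∀ t : Fin n, t ∉ A → t ≠ x → t ≠ y → u s(z, t) = 0 := by
    intro t htA htx hty
    by_cases hto : t = o
    · rw [hto]; exact huo z hzo
    · rw [huoff z t hzo hto]; exact hzN t htA htx hty
  -- goodness of the two children in `G − o`: each sees the three-vertex side `{x, y, z}`
  have hgoodx : KNGood u A hA x b :=
    knGood_twoChildren_threeRelays u A hA x y z b a₁ a₂ a₃ hAeq h12 h13 h23 hx hy hz (Ne.symm hxy) (Ne.symm hxz) hyz hbx hby hbz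
      (fun v _ hvA hvy hvz => hxNu v hvA hvy hvz) (fun t htA htx htz => hyNu t htA htx htz) (fun t htA htx hty => hzNu t htA htx hty)
  have hgoody : KNGood u A hA y b :=
    knGood_twoChildren_threeRelays u A hA y x z b a₁ a₂ a₃ hAeq h12 h13 h23 hy hx hz hxy (Ne.symm hyz) hxz hby hbx hbz
      (fun v _ hvA hvx hvz => hyNu v hvA hvx hvz) (fun t htA hty htz => hxNu t htA hty htz) (fun t htA hty htx => hzNu t htA htx hty)
  -- the witness: the loneliest relay of `G − o`
  obtain ⟨a₀, ha₀, hmin⟩ := A.exists_min_image (fun a => (prodBernoulli u).real (openConn a b)) hA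
  -- sort the relays by their reliability in the core
  set K : Sym2 (Fin n) → unitInterval := fun e => if x ∈ e then 0 else if y ∈ e then 0 else if z ∈ e then 0 else u e with hK
  obtain ⟨b₁, b₂, b₃, hP, hb12, hb13, hb23, hs12, hs23⟩ :=
    exists_sorted_three (fun a => (prodBernoulli K).real (openConn a b)) a₁ a₂ a₃ h12 h13 h23
  have hAeq' : A = {b₁, b₂, b₃} := hAeq.trans hP
  have hGC := gm_grandchild_row u A hA x y z b b₁ b₂ b₃ a₀ hAeq' hb12 hb13 hb23 hxy hxz hyz hx hy hz hbx hby hbz ha₀ hxNu hyNu hzNu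
    K hK hs12 hs23 hmin
  -- the series step
  exact knGood_series_of_gluing w' A hA o x y a₀ b ho hxo hyo hxy ha₀ hbo
    (fun v hvo hvx hvy => by
      rw [hw']; simp only
      by_cases hvA : v ∈ A
      · rw [if_pos ⟨v, hvA, rfl⟩]; rfl
      · rw [if_neg]
        · exact congrArg Subtype.val (hoN v hvo hvA hvx hvy)
        · rintro ⟨q, hq', hvq⟩
          exact hvA ((Sym2.congr_right.1 hvq) ▸ hq'))
    (by rw [hpin]; exact hmin) (by rw [hpin]; exact hgoodx) (by rw [hpin]; exact hgoody) (by rw [hpin]; linarith [hGC])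


open KNGoodGC3Adj in
/-- **Observer with one child above a three-vertex cluster is good.**  `o, x, y, z ∉ A = {a₁,a₂,a₃}` distinct; the pairs at `o` go to
`A ∪ {x}`, at `x` to `A ∪ {o, y, z}`, at `y` to `A ∪ {o, x, z}`, at `z` to `A ∪ {o, x, y}` (so `y, z` are not joined to `o`); `b ∉ {o,x,y,z}`.
Then `KNGood w A hA o b` (Kozma–Nitzan's Theorem 5 + `knGood_twoChildren_threeRelays` in `G ∖ o`). [this work] -/
theorem knGood_oneChild_threeBelow (w : Sym2 (Fin n) → unitInterval) (A : Finset (Fin n)) (hA : A.Nonempty)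
    (o x y z b a₁ a₂ a₃ : Fin n) (hAeq : A = {a₁, a₂, a₃}) (h12 : a₁ ≠ a₂) (h13 : a₁ ≠ a₃) (h23 : a₂ ≠ a₃)
    (ho : o ∉ A) (hx : x ∉ A) (hy : y ∉ A) (hz : z ∉ A) (hxo : x ≠ o) (hyo : y ≠ o) (hzo : z ≠ o) (hxy : x ≠ y) (hxz : x ≠ z)
    (hyz : y ≠ z) (hbo : b ≠ o) (hbx : b ≠ x) (hby : b ≠ y) (hbz : b ≠ z)
    (hoN : ∀ v : Fin n, v ≠ o → v ∉ A → v ≠ x → w s(o, v) = 0)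
    (hxN : ∀ t : Fin n, t ∉ A → t ≠ o → t ≠ y → t ≠ z → w s(x, t) = 0)
    (hyN : ∀ t : Fin n, t ∉ A → t ≠ o → t ≠ x → t ≠ z → w s(y, t) = 0)
    (hzN : ∀ t : Fin n, t ∉ A → t ≠ o → t ≠ x → t ≠ y → w s(z, t) = 0) :
    KNGood w A hA o b := by
  set w' := restrW ({o}ᶜ : Set (Fin n)) w with hw'
  have hres : ∀ p t : Fin n, p ≠ o → t ≠ o → p ≠ t → w' s(p, t) = w s(p, t) := fun p t hp ht hpt =>
    restrW_apply_of_mem w (mk_mem_wireSet_iff.2 ⟨Set.mem_compl_singleton_iff.2 hp, Set.mem_compl_singleton_iff.2 ht, hpt⟩)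
  have hres0 : ∀ p t : Fin n, (t = o ∨ p = t) → w' s(p, t) = 0 := by
    intro p t h
    refine restrW_apply_of_not_mem w fun hm => ?_
    obtain ⟨-, ht, hpt⟩ := mk_mem_wireSet_iff.1 hm
    rcases h with rfl | rfl
    · exact (Set.mem_compl_singleton_iff.1 ht) rfl
    · exact hpt rfl
  have hval : ∀ p t : Fin n, p ≠ o → (t ≠ o → p ≠ t → w s(p, t) = 0) → w' s(p, t) = 0 := by
    intro p t hp h
    by_cases hto : t = o
    · exact hres0 p t (Or.inl hto)
    by_cases hpt : p = t
    · exact hres0 p t (Or.inr hpt)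
    rw [hres p t hp hto hpt]; exact h hto hpt
  refine KozmaNitzan2024_thm5 w A hA o b x ho hbo hxo hoN ?_
  rw [← hw']
  exact knGood_twoChildren_threeRelays w' A hA x y z b a₁ a₂ a₃ hAeq h12 h13 h23 hx hy hz (Ne.symm hxy) (Ne.symm hxz) hyz hbx hby hbz
    (fun v hvx hvA hvy hvz => hval x v hxo fun hvo _ => hxN v hvA hvo hvy hvz)
    (fun t htA htx htz => hval y t hyo fun hto _ => hyN t htA hto htx htz)
    (fun t htA htx hty => hval z t hzo fun hto _ => hzN t htA hto htx hty)

end KNGoodGMgc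

end Summit.CriticalPhenomena.PercolationContinuityZ3.Theorems

end
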